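import Summits.Ventures.LatticeQCDFlow.Scaling.SimulatedTemperingFiniteGap
import Literature.Probability.MarkovChains.BottleneckRatioSpectralGap
import Literature.Probability.MarkovChains.SpectralGapTestFunction
import Literature.Probability.MarkovChains.AsymptoticVarianceSpectral

/-!
HONEST FRAMING: exact (Metropolis-corrected) sampling algorithms for lattice gauge theory; figures
of merit are autocorrelation/cost numbers at stated couplings and volumes; no continuum-physics
claim.

# SimulatedTemperingModeTorpid — TEMPERING DOES NOT CREATE TUNNELLING, IT IMPORTS IT: FOR EVERY SET `A` OF
# CONFIGURATIONS (A MODE, A TOPOLOGICAL SECTOR) THE SAMPLER'S EXIT FLOW FROM "`A` AT ANY LEVEL" IS THE LADDER AVERAGE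
# OF THE WITHIN-LEVEL EXIT FLOWS, SO `Gap ≤ (1−t)(K+1)·Σ_k Q_k(A,Aᶜ)/(m_A((K+1) − m_A))`,
# `t_mix ≥ m_A/(4(1−t)Σ_k Q_k(A,Aᶜ))` AND `τ_int(sector indicator) ≥ m_A((K+1) − m_A)/((1−t)(K+1)Σ_k Q_k(A,Aᶜ)) − ½`
# (`m_A = Σ_k μ_k(A)`) — WHATEVER THE LADDER (lean-2 GEN-17, ours)

Venture-side (OURS).  Cell `lqcd-flow` (pub-lqcd), unit `pub-lqcd-lean-2-g17`, 2026-08-25.  The converse direction of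
chapter Y (`Scaling/SimulatedTemperingMode*`).  Setting of chapter X: finite configuration space `S`, levels
`μ_k` (positive probability vectors, exact weights), within-level updates `M_k` (row-stochastic, `μ_k`-reversible),
the random-scan sampler `P = stFinSampler t μ M` on `Fin (K+1) × S` with target `π = stFinLaw μ`
(`π(k,x) = μ_k(x)/(K+1)`).  For a set of configurations `A : Finset S` let `T = univ ×ˢ A` ("in `A`, at any level"),
`m_A = Σ_k μ_k(A)` (so `π(T) = m_A/(K+1)`), and `Q_k(A,Aᶜ) = Σ_{x ∈ A, y ∉ A} μ_k(x)M_k(x,y)` the stationary one-step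
exit flow of the level-`k` update (Literature `edgeMeasure (μ k) (M k) A Aᶜ`; `Q_k(A,Aᶜ)/μ_k(A)` is its bottleneck
ratio = the probability to leave `A` in one step from equilibrium inside `A`).

## What is proved (finite-chain vocabulary of `Literature.Probability.MarkovChains`)

* §1 `compl_univ_product`, `stFin_mass_product` (`π(T) = m_A/(K+1)`), **`stFin_edgeMeasure_product`** — THE LEVEL
  MOVE NEVER LEAVES `T` (it keeps the configuration), so `Q_P(T,Tᶜ) = ((1−t)/(K+1))·Σ_k Q_k(A,Aᶜ)` EXACTLY;
  **`stFin_bottleneckRatio_product`** — `Φ_P(T) = (1−t)·Σ_k Q_k(A,Aᶜ)/m_A`, i.e. `(1−t)` times the average of the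
  level bottleneck ratios `Φ_k(A)` weighted by the masses `μ_k(A)`: the hot levels' tunnelling enters only in
  proportion to the weight the set keeps there (persistence).
* §2 **`stFin_spectralGap_le_sector`** — `Gap(P) ≤ (1−t)(K+1)·Σ_k Q_k(A,Aᶜ)/(m_A((K+1) − m_A))` for every `A` with
  `0 < m_A < K+1` (test function `f_T`, Levin–Peres–Wilmer Remark 13.8 + Lemma 13.7, PROVED in the tree);
  `stFin_spectralGap_le_two_mul` — `Gap(P) ≤ 2(1−t)·Σ_k Q_k(A,Aᶜ)/m_A` when `m_A ≤ (K+1)/2` (Theorem 13.10, upper).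
* §3 **`stFin_mixing_floor_sector`** — every time `n` with `d(n) ≤ ¼` has `m_A ≤ 4n(1−t)·Σ_k Q_k(A,Aᶜ)`
  (Levin–Peres–Wilmer Theorem 7.4 per set, PROVED in the tree; no reversibility of the conclusion's use needed).
* §4 `tauInt_ge_var_div_dirichletForm` (generic: `τ_int(g) = asympVar/(2Var) ≥ Var_π(g)/𝓔_P(g) − ½`, Madras–Slade
  Prop. 9.2.2 route) and **`stFin_tauInt_sector_ge`** — for the centred sector indicator `f_T` (an affine function of
  `1_A`, same autocorrelations): `τ_int(f_T) ≥ m_A((K+1) − m_A)/((1−t)(K+1)·Σ_k Q_k(A,Aᶜ)) − ½` (`0 < t < 1`,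
  irreducible `M_k`).

Reading (no numerics implied).  A simulated-tempering sampler relaxes the indicator of a topological sector no faster
than the LADDER-AVERAGED exit flow of that sector allows; if the sector is frozen at every level where it carries
weight (`Q_k(A,Aᶜ) ≤ ε·μ_k(A)` for all `k`), then `Gap ≤ 2(1−t)ε` and `τ_int ≥ (1 − π(T))/(2(1−t)ε)·…` — tempering in
the coupling helps exactly through levels where the sector both persists and tunnels (the quantitative content of
"persistence", Woodard–Schmidler–Huber 2009).  The matching positive statement (gap floor from within-mode gaps,
hot-level gap, restricted overlaps and persistence) is `Scaling/SimulatedTemperingModeGap`.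

NOT CLAIMED: that the bound is attained; replica exchange (the same computation with the product replica update —
not typed here); general configuration spaces; anything measured.  Literature grade (cell rule): KNOWN MECHANISM
(conductance / test-function ceilings on spectral gaps; torpid mixing of tempering from persistence,
Woodard–Schmidler–Huber, Electron. J. Probab. 14 (2009) 780–804; Bhatnagar–Randall 2004), NEW TYPING (the exact
exit-flow identity for the exact-weight finite sampler and its three consequences); nothing cited as a fact; no new
bib keys.
-/

noncomputable section

open Finset
open Literature.Probability.MarkovChains

namespace Summit.Ventures.LatticeQCDFlow.Scaling

/-! ## §4 (generic) `τ_int ≥ Var/𝓔 − ½` -/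

section Generic

variable {X : Type*} [Fintype X] [DecidableEq X] {π : X → ℝ} {P : Matrix X X ℝ}

/-- The Dirichlet form of a NON-CONSTANT observable of a reversible irreducible chain is positive (else the
Madras–Slade inequality `Var(Var + C₁) ≤ asympVar·𝓔` would read `2Var² ≤ 0`). [ours] -/
theorem dirichletForm_pos_of_lawVariance_pos (hπ : ∀ x, 0 < π x) (hπ1 : ∑ x, π x = 1)
    (hP : IsRowStochastic P) (hDB : DetailedBalance π P) (hirr : IsIrreducible P) {g : X → ℝ}
    (hV : 0 < lawVariance π g) : 0 < dirichletForm π P g := by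
  have hst : IsStationary π P := hDB.isStationary hP.2
  have key := asympVar_mul_dirichletForm_ge hπ hπ1 hP hDB hirr g
  have h928 := MadrasSlade1993_eq_9_2_28 hP hst g
  by_contra h
  push Not at h
  have hE0 : dirichletForm π P g = 0 := le_antisymm h (dirichletForm_nonneg (fun x => (hπ x).le) hP.1 _)
  rw [hE0] at h928
  have hC1 : piInner π (centred π g) (P.mulVec (centred π g)) = lawVariance π g := by linarith
  rw [hC1, sub_self, mul_zero] at key
  nlinarith

/-- **`τ_int(g) ≥ Var_π(g)/𝓔_P(g) − ½`** for a reversible irreducible chain and a non-constant observable: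
`asympVar(g)/(2Var_π(g)) ≥ Var_π(g)/𝓔_P(g) − ½` (Madras–Slade Prop. 9.2.2: `τ_int ≥ ½(1+ρ₁)/(1−ρ₁)` with
`1 − ρ₁ = 𝓔/Var`). [ours] -/
theorem tauInt_ge_var_div_dirichletForm (hπ : ∀ x, 0 < π x) (hπ1 : ∑ x, π x = 1) (hP : IsRowStochastic P)
    (hDB : DetailedBalance π P) (hirr : IsIrreducible P) {g : X → ℝ} (hV : 0 < lawVariance π g) :
    lawVariance π g / dirichletForm π P g - 1 / 2 ≤ asympVar g π P / (2 * lawVariance π g) := by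
  have hst : IsStationary π P := hDB.isStationary hP.2
  have key := asympVar_mul_dirichletForm_ge hπ hπ1 hP hDB hirr g
  have h928 := MadrasSlade1993_eq_9_2_28 hP hst g
  have hEpos := dirichletForm_pos_of_lawVariance_pos hπ hπ1 hP hDB hirr hV
  set V := lawVariance π g with hVdef
  set C1 := piInner π (centred π g) (P.mulVec (centred π g)) with hC1
  set E := dirichletForm π P g with hEdef
  have hC1E : C1 = V - E := by linarith
  rw [hC1E] at key
  have e : V / E - 1 / 2 = (2 * V - E) / (2 * E) := by field_simp
  rw [e, div_le_div_iff₀ (by positivity) (by positivity)]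
  nlinarith [key]

end Generic

variable {S : Type*} [Fintype S] [DecidableEq S] {K : ℕ} {μ : Fin (K + 1) → S → ℝ}
  {M : Fin (K + 1) → Matrix S S ℝ} {t : ℝ}

/-! ## §1 The set "in `A`, at any level": mass and exit flow -/

omit [DecidableEq S] in
/-- The complement of `univ ×ˢ A` is `univ ×ˢ Aᶜ`. [ours] -/
theorem compl_univ_product [DecidableEq S] (A : Finset S) :
    ((univ : Finset (Fin (K + 1))) ×ˢ A)ᶜ = (univ : Finset (Fin (K + 1))) ×ˢ Aᶜ := by
  ext p
  simp [Finset.mem_product]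

omit [Fintype S] [DecidableEq S] in
/-- **`π(T) = m_A/(K+1)`**, `m_A = Σ_k μ_k(A)`. [ours] -/
theorem stFin_mass_product (A : Finset S) :
    ∑ p ∈ (univ : Finset (Fin (K + 1))) ×ˢ A, stFinLaw μ p = (∑ k, ∑ x ∈ A, μ k x) / (K + 1) := by
  rw [Finset.sum_product, Finset.sum_div]
  refine sum_congr rfl fun k _ => ?_
  rw [Finset.sum_div]
  exact sum_congr rfl fun x _ => rfl

/-- **The exit flow from `T = univ ×ˢ A` is the ladder average of the within-level exit flows:**
`Q_P(T,Tᶜ) = ((1−t)/(K+1))·Σ_k Q_k(A,Aᶜ)` — the level move keeps the configuration and never leaves `T`. [ours] -/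
theorem stFin_edgeMeasure_product (A : Finset S) :
    edgeMeasure (stFinLaw μ) (stFinSampler t μ M) ((univ : Finset (Fin (K + 1))) ×ˢ A)
        (((univ : Finset (Fin (K + 1))) ×ˢ A)ᶜ)
      = (1 - t) / (K + 1) * ∑ k, edgeMeasure (μ k) (M k) A Aᶜ := by
  rw [compl_univ_product]
  unfold edgeMeasure
  rw [Finset.sum_product, Finset.mul_sum]
  refine sum_congr rfl fun k _ => ?_
  rw [Finset.mul_sum]
  refine sum_congr rfl fun x hx => ?_
  rw [Finset.sum_product,
    Finset.sum_eq_single k (fun l _ hlk => ?_) (fun h => absurd (mem_univ k) h)]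
  · rw [Finset.mul_sum]
    refine sum_congr rfl fun y hy => ?_
    have hne : ((k, y) : Fin (K + 1) × S).2 ≠ ((k, x) : Fin (K + 1) × S).2 := by
      intro e
      have e' : y = x := e
      rw [Finset.mem_compl] at hy
      exact hy (by rw [e']; exact hx)
    rw [stFinSampler_apply, stFinLevel_eq_zero_of_ne hne, mul_zero, zero_add, stFinWithin_apply, if_pos rfl]
    unfold stFinLaw
    ring
  · refine Finset.sum_eq_zero fun y hy => ?_
    have hne : ((l, y) : Fin (K + 1) × S).2 ≠ ((k, x) : Fin (K + 1) × S).2 := by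
      intro e
      have e' : y = x := e
      rw [Finset.mem_compl] at hy
      exact hy (by rw [e']; exact hx)
    have hl : ¬ ((l, y) : Fin (K + 1) × S).1 = ((k, x) : Fin (K + 1) × S).1 := hlk
    rw [stFinSampler_apply, stFinLevel_eq_zero_of_ne hne, mul_zero, zero_add, stFinWithin_apply, if_neg hl,
      mul_zero, mul_zero]

/-- **The bottleneck ratio of `T` is `(1−t)` times the `μ_k(A)`-weighted average of the level bottleneck ratios:**
`Φ_P(T) = (1−t)·Σ_k Q_k(A,Aᶜ)/Σ_k μ_k(A)`. [ours] -/
theorem stFin_bottleneckRatio_product (A : Finset S) :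
    bottleneckRatio (stFinLaw μ) (stFinSampler t μ M) ((univ : Finset (Fin (K + 1))) ×ˢ A)
      = (1 - t) * (∑ k, edgeMeasure (μ k) (M k) A Aᶜ) / (∑ k, ∑ x ∈ A, μ k x) := by
  unfold bottleneckRatio
  rw [stFin_edgeMeasure_product, stFin_mass_product]
  by_cases hm : (∑ k, ∑ x ∈ A, μ k x) = 0
  · rw [hm]; simp
  · field_simp

/-! ## §2 The spectral-gap ceiling -/

section Gap

variable (hμ : ∀ k x, 0 < μ k x) (hμ1 : ∀ k, ∑ x, μ k x = 1) (hM : ∀ k, IsRowStochastic (M k))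
  (hMrev : ∀ k, DetailedBalance (μ k) (M k))
include hμ hμ1 hM hMrev

omit [DecidableEq S] hμ hM hMrev in
/-- A set of intermediate mass witnesses two distinct states. [ours] -/
theorem stFin_nontrivial_of_mass {A : Finset S} (hA0 : 0 < ∑ k, ∑ x ∈ A, μ k x)
    (hA1 : ∑ k, ∑ x ∈ A, μ k x < K + 1) : Nontrivial (Fin (K + 1) × S) := by
  classical
  have hT : ((univ : Finset (Fin (K + 1))) ×ˢ A).Nonempty := by
    by_contra h
    rw [Finset.not_nonempty_iff_eq_empty] at h
    have := stFin_mass_product (μ := μ) A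
    rw [h, Finset.sum_empty] at this
    have : (∑ k, ∑ x ∈ A, μ k x) = 0 := by
      have hK : (0 : ℝ) < K + 1 := by positivity
      field_simp at this
      linarith
    linarith
  have hTc : (((univ : Finset (Fin (K + 1))) ×ˢ A)ᶜ).Nonempty := by
    by_contra h
    rw [Finset.not_nonempty_iff_eq_empty, Finset.compl_eq_empty_iff] at h
    have e1 := stFin_mass_product (μ := μ) A
    rw [h, sum_stFinLaw hμ1] at e1
    have hK : (0 : ℝ) < K + 1 := by positivity
    rw [eq_div_iff hK.ne'] at e1
    linarith
  obtain ⟨p, hp⟩ := hT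
  obtain ⟨q, hq⟩ := hTc
  refine ⟨⟨p, q, fun e => ?_⟩⟩
  rw [Finset.mem_compl] at hq
  exact hq (e ▸ hp)

/-- **THE GAP CEILING: `Gap(P) ≤ (1−t)(K+1)·Σ_k Q_k(A,Aᶜ)/(m_A((K+1) − m_A))`** for every set of configurations with
`0 < m_A < K+1` (`0 ≤ t ≤ 1`) — the test function `f_T` has `𝓔 = Q_P(T,Tᶜ)` and `Var = π(T)π(Tᶜ)`. [ours] -/
theorem stFin_spectralGap_le_sector (ht0 : 0 ≤ t) (ht1 : t ≤ 1) (A : Finset S)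
    (hA0 : 0 < ∑ k, ∑ x ∈ A, μ k x) (hA1 : ∑ k, ∑ x ∈ A, μ k x < K + 1) :
    spectralGap (stFinLaw μ) (stFinSampler t μ M)
      ≤ (1 - t) * (K + 1) * (∑ k, edgeMeasure (μ k) (M k) A Aᶜ)
          / ((∑ k, ∑ x ∈ A, μ k x) * ((K + 1) - ∑ k, ∑ x ∈ A, μ k x)) := by
  haveI := stFin_nontrivial_of_mass hμ1 hA0 hA1
  set T := (univ : Finset (Fin (K + 1))) ×ˢ A with hT
  have hP := stFinSampler_isRowStochastic (M := M) hμ hM ht0 ht1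
  have hDB := stFinSampler_detailedBalance (t := t) (M := M) hμ hMrev
  have hst : IsStationary (stFinLaw μ) (stFinSampler t μ M) := hDB.isStationary hP.2
  have hπ1 := sum_stFinLaw (K := K) hμ1
  have hK : (0 : ℝ) < K + 1 := by positivity
  -- mass and co-mass of `T`
  have hmT : ∑ p ∈ T, stFinLaw μ p = (∑ k, ∑ x ∈ A, μ k x) / (K + 1) := stFin_mass_product A
  have hmTc : ∑ p ∈ Tᶜ, stFinLaw μ p = ((K + 1) - ∑ k, ∑ x ∈ A, μ k x) / (K + 1) := by
    have h := sum_add_sum_compl T (stFinLaw μ)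
    rw [hπ1, hmT] at h
    field_simp at h
    rw [eq_div_iff hK.ne']
    linarith
  have hVar : lawVariance (stFinLaw μ) (bottleneckTestFun (stFinLaw μ) T)
      = (∑ k, ∑ x ∈ A, μ k x) / (K + 1) * (((K + 1) - ∑ k, ∑ x ∈ A, μ k x) / (K + 1)) := by
    rw [lawVariance_bottleneckTestFun hπ1, hmT, hmTc]
  have hVpos : 0 < lawVariance (stFinLaw μ) (bottleneckTestFun (stFinLaw μ) T) := by
    rw [hVar]; exact mul_pos (div_pos hA0 hK) (div_pos (by linarith) hK)
  have hE : dirichletForm (stFinLaw μ) (stFinSampler t μ M) (bottleneckTestFun (stFinLaw μ) T)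
      = (1 - t) / (K + 1) * ∑ k, edgeMeasure (μ k) (M k) A Aᶜ := by
    rw [dirichletForm_bottleneckTestFun hP hst hπ1, hT, stFin_edgeMeasure_product]
  rw [LevinPeres2017_lemma_13_7 (stFinLaw_pos hμ) hπ1 hP hDB]
  refine (spectralGapR_le_dirichletForm_div_lawVariance (fun p => (stFinLaw_pos hμ p).le) hπ1 hP.1 hVpos).trans
    (le_of_eq ?_)
  rw [hE, hVar]
  field_simp

/-- **Levin–Peres–Wilmer Theorem 13.10 (upper) for the sampler:** `Gap(P) ≤ 2Φ_P(T) = 2(1−t)·Σ_k Q_k(A,Aᶜ)/m_A`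
when `0 < m_A ≤ (K+1)/2`. [ours] -/
theorem stFin_spectralGap_le_two_mul (ht0 : 0 ≤ t) (ht1 : t ≤ 1) (A : Finset S)
    (hA0 : 0 < ∑ k, ∑ x ∈ A, μ k x) (hA1 : ∑ k, ∑ x ∈ A, μ k x ≤ (K + 1) / 2) :
    spectralGap (stFinLaw μ) (stFinSampler t μ M)
      ≤ 2 * ((1 - t) * (∑ k, edgeMeasure (μ k) (M k) A Aᶜ) / (∑ k, ∑ x ∈ A, μ k x)) := by
  have hK : (0 : ℝ) < K + 1 := by positivity
  haveI := stFin_nontrivial_of_mass hμ1 hA0 (by linarith)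
  have hP := stFinSampler_isRowStochastic (M := M) hμ hM ht0 ht1
  have hDB := stFinSampler_detailedBalance (t := t) (M := M) hμ hMrev
  have hst : IsStationary (stFinLaw μ) (stFinSampler t μ M) := hDB.isStationary hP.2
  have hπ1 := sum_stFinLaw (K := K) hμ1
  have hmT : ∑ p ∈ (univ : Finset (Fin (K + 1))) ×ˢ A, stFinLaw μ p = (∑ k, ∑ x ∈ A, μ k x) / (K + 1) :=
    stFin_mass_product A
  have hS0 : 0 < ∑ p ∈ (univ : Finset (Fin (K + 1))) ×ˢ A, stFinLaw μ p := by rw [hmT]; positivity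
  have hS : ∑ p ∈ (univ : Finset (Fin (K + 1))) ×ˢ A, stFinLaw μ p ≤ 1 / 2 := by
    rw [hmT, div_le_iff₀ hK]; linarith
  rw [LevinPeres2017_lemma_13_7 (stFinLaw_pos hμ) hπ1 hP hDB, ← stFin_bottleneckRatio_product]
  exact LevinPeres2017_thm_13_10_upper_set hP hst (fun p => (stFinLaw_pos hμ p).le) hπ1 hS0 hS

/-! ## §3 The mixing-time floor -/

/-- **Levin–Peres–Wilmer Theorem 7.4 for the sampler:** if the chain is within `¼` of equilibrium in total variation
from every start at time `n`, then `m_A ≤ 4n(1−t)·Σ_k Q_k(A,Aᶜ)` for every `A` with `0 < m_A ≤ (K+1)/2` — i.e.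
`t_mix ≥ m_A/(4(1−t)Σ_k Q_k(A,Aᶜ))`. [ours] -/
theorem stFin_mixing_floor_sector (ht0 : 0 ≤ t) (ht1 : t ≤ 1) (A : Finset S)
    (hA0 : 0 < ∑ k, ∑ x ∈ A, μ k x) (hA1 : ∑ k, ∑ x ∈ A, μ k x ≤ (K + 1) / 2) {n : ℕ}
    (hn : worstTvDist (stFinSampler t μ M) (stFinLaw μ) n ≤ 1 / 4) :
    ∑ k, ∑ x ∈ A, μ k x ≤ 4 * n * ((1 - t) * ∑ k, edgeMeasure (μ k) (M k) A Aᶜ) := by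
  have hK : (0 : ℝ) < K + 1 := by positivity
  have hP := stFinSampler_isRowStochastic (M := M) hμ hM ht0 ht1
  have hDB := stFinSampler_detailedBalance (t := t) (M := M) hμ hMrev
  have hst : IsStationary (stFinLaw μ) (stFinSampler t μ M) := hDB.isStationary hP.2
  have hπ1 := sum_stFinLaw (K := K) hμ1
  have hmT : ∑ p ∈ (univ : Finset (Fin (K + 1))) ×ˢ A, stFinLaw μ p = (∑ k, ∑ x ∈ A, μ k x) / (K + 1) :=
    stFin_mass_product A
  have hS0 : 0 < ∑ p ∈ (univ : Finset (Fin (K + 1))) ×ˢ A, stFinLaw μ p := by rw [hmT]; positivity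
  have hS : ∑ p ∈ (univ : Finset (Fin (K + 1))) ×ˢ A, stFinLaw μ p ≤ 1 / 2 := by
    rw [hmT, div_le_iff₀ hK]; linarith
  have h := LevinPeres2017_thm_7_4_set hP hst (fun p => (stFinLaw_pos hμ p).le) hπ1 hS0 hS hn
  rw [stFin_bottleneckRatio_product] at h
  have h' : 1 ≤ (4 * n * ((1 - t) * ∑ k, edgeMeasure (μ k) (M k) A Aᶜ)) / ∑ k, ∑ x ∈ A, μ k x := by
    calc (1 : ℝ) ≤ _ := h
      _ = _ := by ring
  rwa [le_div_iff₀ hA0, one_mul] at h'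

/-! ## §4 The autocorrelation floor for the sector indicator -/

/-- **THE SECTOR INDICATOR STAYS CORRELATED:** for `0 < t < 1`, irreducible within-level updates and every `A` with
`0 < m_A < K+1`, the centred sector indicator `f_T` (Literature `bottleneckTestFun`; an affine function of `1_A`) has
`τ_int(f_T) = asympVar/(2Var) ≥ m_A((K+1) − m_A)/((1−t)(K+1)·Σ_k Q_k(A,Aᶜ)) − ½`. [ours] -/
theorem stFin_tauInt_sector_ge (hMirr : ∀ k, IsIrreducible (M k)) (ht0 : 0 < t) (ht1 : t < 1)
    (A : Finset S) (hA0 : 0 < ∑ k, ∑ x ∈ A, μ k x) (hA1 : ∑ k, ∑ x ∈ A, μ k x < K + 1) :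
    (∑ k, ∑ x ∈ A, μ k x) * ((K + 1) - ∑ k, ∑ x ∈ A, μ k x)
          / ((1 - t) * (K + 1) * ∑ k, edgeMeasure (μ k) (M k) A Aᶜ) - 1 / 2
      ≤ asympVar (bottleneckTestFun (stFinLaw μ) ((univ : Finset (Fin (K + 1))) ×ˢ A)) (stFinLaw μ)
            (stFinSampler t μ M)
          / (2 * lawVariance (stFinLaw μ) (bottleneckTestFun (stFinLaw μ) ((univ : Finset (Fin (K + 1))) ×ˢ A))) := by
  set T := (univ : Finset (Fin (K + 1))) ×ˢ A with hT
  have hP := stFinSampler_isRowStochastic (M := M) hμ hM ht0.le ht1.le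
  have hDB := stFinSampler_detailedBalance (t := t) (M := M) hμ hMrev
  have hst : IsStationary (stFinLaw μ) (stFinSampler t μ M) := hDB.isStationary hP.2
  have hirr := stFinSampler_isIrreducible hμ hM hMirr ht0 ht1
  have hπ1 := sum_stFinLaw (K := K) hμ1
  have hK : (0 : ℝ) < K + 1 := by positivity
  have hmT : ∑ p ∈ T, stFinLaw μ p = (∑ k, ∑ x ∈ A, μ k x) / (K + 1) := stFin_mass_product A
  have hmTc : ∑ p ∈ Tᶜ, stFinLaw μ p = ((K + 1) - ∑ k, ∑ x ∈ A, μ k x) / (K + 1) := by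
    have h := sum_add_sum_compl T (stFinLaw μ)
    rw [hπ1, hmT] at h
    field_simp at h
    rw [eq_div_iff hK.ne']
    linarith
  have hVar : lawVariance (stFinLaw μ) (bottleneckTestFun (stFinLaw μ) T)
      = (∑ k, ∑ x ∈ A, μ k x) / (K + 1) * (((K + 1) - ∑ k, ∑ x ∈ A, μ k x) / (K + 1)) := by
    rw [lawVariance_bottleneckTestFun hπ1, hmT, hmTc]
  have hVpos : 0 < lawVariance (stFinLaw μ) (bottleneckTestFun (stFinLaw μ) T) := by
    rw [hVar]; exact mul_pos (div_pos hA0 hK) (div_pos (by linarith) hK)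
  have hE : dirichletForm (stFinLaw μ) (stFinSampler t μ M) (bottleneckTestFun (stFinLaw μ) T)
      = (1 - t) / (K + 1) * ∑ k, edgeMeasure (μ k) (M k) A Aᶜ := by
    rw [dirichletForm_bottleneckTestFun hP hst hπ1, hT, stFin_edgeMeasure_product]
  have hQpos : 0 < ∑ k, edgeMeasure (μ k) (M k) A Aᶜ := by
    have hEpos := dirichletForm_pos_of_lawVariance_pos (stFinLaw_pos hμ) hπ1 hP hDB hirr hVpos
    rw [hE] at hEpos
    exact (mul_pos_iff_of_pos_left (div_pos (by linarith) hK)).mp hEpos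
  have key := tauInt_ge_var_div_dirichletForm (stFinLaw_pos hμ) hπ1 hP hDB hirr hVpos
  rw [hE] at key
  have eL : (∑ k, ∑ x ∈ A, μ k x) * ((K + 1) - ∑ k, ∑ x ∈ A, μ k x)
        / ((1 - t) * (K + 1) * ∑ k, edgeMeasure (μ k) (M k) A Aᶜ)
      = lawVariance (stFinLaw μ) (bottleneckTestFun (stFinLaw μ) T)
          / ((1 - t) / (K + 1) * ∑ k, edgeMeasure (μ k) (M k) A Aᶜ) := by
    rw [hVar]
    have h1t : (1 - t) ≠ 0 := by linarith
    field_simp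
  rw [eL]
  exact key

end Gap

end Summit.Ventures.LatticeQCDFlow.Scaling

end
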